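import Literature.AlgebraicGeometry.Motives.FaltingsTatePotentiallyIsogenous
import Literature.NumberTheory.ComplexMultiplication.CMStructureIsogenousPrimitivePower
import Literature.NumberTheory.ComplexMultiplication.FaltingsTateOfPrimitiveCM
import Literature.NumberTheory.ComplexMultiplication.FaltingsTateOfCMElliptic
import Literature.NumberTheory.ComplexMultiplication.HeckeCharacterIsogenyRational
import Literature.NumberTheory.ComplexMultiplication.CMStructureUniformized
import Literature.AlgebraicGeometry.Motives.FaltingsTateFiniteBiproductAdditivity
import HarnessLib

/-!
# [Faltings 1983, §5 Kor. 1] for the `k`-forms («twists») of a CM structure: structures of one type are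
# geometrically isogenous, and the Tate statement descends from a finite normal extension

Topic `Literature/NumberTheory/ComplexMultiplication`, namespace `Literature.NumberTheory.ComplexMultiplication`.
THEOREMS ONLY (no definition, no named fact, no instance; net Literature debt 0).  Cell `hodgecm-mathlib`
(D-0151), T5 distance ledger of the floor binder `hFal` (row VI-1 of `stmt-HodgeConjecture-24832`), item
(O-N8) «twist family»: the one CM-elliptic PAIR family not covered by ★ `FaltingsTateOfCMEllipticPair`
(same Hecke character ⇒ `k`-isogenous, [Shimura1998] Lemma 19.12) and ★ `FaltingsTateOfDistinctCMFields`
(non-isomorphic CM fields) — two structures of the SAME type `(K, Φ)` over `k` which need NOT be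
`k`-isogenous (quadratic/cubic/sextic twists of a CM elliptic curve; for general `g`, all `k`-forms).

THE ARGUMENT ([Fal83] §5: «Wir dürfen `K` durch eine endliche Erweiterung ersetzen» + Kor. 1 ⇐ Satz 4):
* §1 (`faltings_tate_bijective_of_isIsogenous_baseChange_complex`, GENERIC).  If `A ⊗_k ℂ ∼ A′ ⊗_k ℂ` for abelian
  varieties `A, A′` over a number field `k ⊂ ℂ`, there is ONE finite `L′ ⊂ ℂ` over `k` over which all complex
  homomorphisms between them (both ways) are rational (★ `exists_intermediateField_forall_le_surjective_homBaseChange`,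
  [Shimura1998] Ch. I §1.2 / §18.6 (iv)), with freedom to enlarge to a finite `N ⊂ ℂ` normal over `ℚ`
  (★ `exists_intermediateField_normal_rat_le`); there the complex isogeny descends (★ `IsIsogenous.of_surjective_homBaseChange`),
  and the `End` statement for `A ⊗ N` gives [Fal83 Kor. 1] for `(A, A′)`, `(A′, A)`, `(A′, A′)` over `k`
  (★ `faltings_tate_bijective_of_isIsogenous_baseChange`, `Motives/FaltingsTatePotentiallyIsogenous`).
* §2 (`IsCMTypeRealisationOver.isIsogenous_baseChange_complex`).  Two structures `(A, ι)`, `(A′, ι′)` of the SAME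
  type `(K, Φ)` over `k` (ANY CM field `K`) have isogenous complexifications: both are uniformised,
  `ℂ^Φ/Φ(𝔞)` and `ℂ^Φ/Φ(𝔟)` ([Shimura1998] §6.1 Thm. 2 / (18.4a), ★ `exists_cmTypeUniformization`), and for
  `0 ≠ γ ∈ 𝔞⁻¹𝔟` the `(γ𝔟⁻¹𝔞)`-multiplication `S(γ)` is an isogeny ([Shimura1998] §7.4 Prop. 15, §7.1 Prop. 7;
  ★ `exists_hom_forall_map_r_eq`, ★ `isIsogeny_of_map_r_eq_mul`).
* §3 The `End` statement over every finite normal `N ⊂ ℂ` for a structure of PRIMITIVE type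
  (★ `FaltingsTateOfPrimitiveCM`: Shimura–Taniyama scalar Frobenius with `ℚ(π) = K` + Serre–Tate §4 Cor. 1,
  granted [Shimura1998, Thm. 18.6] = `h186`; base change keeps the type, ★ `IsCMTypeRealisationOver.baseChange`)
  and for a CM ELLIPTIC structure (★ `FaltingsTateOfCMElliptic`, `[K : ℚ] = 2`); hence
  **`faltings_tate_bijective_of_isIsogenous_complex_of_isPrimitive_of_thm18_6`**: for a structure `(A₀, ι₀)` of
  primitive type over `k` and ANY abelian variety `A′` over `k` with `A′ ⊗ ℂ ∼ A₀ ⊗ ℂ` (every `k`-form of a variety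
  geometrically isogenous to `A₀`: twists, and e.g. elliptic curves with CM by a non-maximal order of `K`), the
  Tate map is bijective for `(A₀, A′)`, `(A′, A₀)`, `(A′, A′)`.
* §4 HEADS: **`faltings_tate_bijective_of_sameType_of_isPrimitive_of_thm18_6`** — two structures `(A, ι)`,
  `(A′, ι′)` of one primitive type `(K, Φ)` over `k` satisfy `faltings_tate_bijective A A′ ℓ` for every `ℓ`,
  granted `h186` and NOTHING ELSE (no Hecke character, no uniformisation, no `k`-isogeny hypothesis); the
  CM-elliptic spelling `…_of_sameType_of_CM_elliptic_of_thm18_6` (`[K : ℚ] = 2`).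
* §5 Products: for two finite families of structures, ALL of one primitive type `(K, Φ)` over `k`, and `A ∼ ⨁ Aⱼ`,
  `B ∼ ⨁ Bⱼ′`, `faltings_tate_bijective A B ℓ` (★ `faltings_tate_bijective_of_isIsogenous_biproduct_biproduct`,
  [Fal83 Kor. 1] additivity) — e.g. any two products of twists of one CM elliptic curve.

Books: 0 (witness family on the T5 distance ledger; `hFal` is consumed at a non-CM pair).  HC_CM is proved
only modulo the printed citations of the floor until rung 0 closes; this file moves no floor binder.

## References

* [Faltings1983Endlichkeit] G. Faltings, Invent. Math. 73 (1983), §5: proof of Satz 4 (p. 360), Korollar 1 (p. 361).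
* [Shimura1998] G. Shimura, *Abelian Varieties with Complex Multiplication and Modular Functions* (1998):
  Ch. I §1.2; §6.1 Thm. 2; §7.1 Prop. 7 (p. 47); §7.4 Prop. 15 (p. 53); §18.4 (18.4a);
  §18.6 proof of Thm. 18.6 (iv) (p. 127); Thm. 18.6.
* [SerreTate1968] J.-P. Serre, J. Tate, Ann. of Math. 88 (1968), §4 Thm. 5 and Cor. 1.
* [MumfordAV1970] D. Mumford, *Abelian Varieties* (1970), §19 Thm. 3 (p. 176) and Remark p. 169.
-/

set_option autoImplicit false

noncomputable section

open CategoryTheory NumberField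
open scoped NumberField nonZeroDivisors

namespace Literature.NumberTheory.ComplexMultiplication

open Literature.AlgebraicGeometry.Motives Literature.AlgebraicGeometry.Motives.AbelianVariety

/-! ## §1 Complex-isogenous `k`-forms: [Fal83 Kor. 1] from the `End` statement over finite normal extensions -/

section Complex

variable {k : Type} [Field k] [NumberField k] [Algebra k ℂ] (ℓ : ℕ) [Fact ℓ.Prime]

/-- **[Fal83 §5 Kor. 1] for complex-isogenous `k`-forms.**  Let `A, A′` be abelian varieties over a number
field `k ⊂ ℂ` with `A ⊗_k ℂ ∼ A′ ⊗_k ℂ`, and suppose the `End` statement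
`faltings_tate_bijective (A ⊗_k N) (A ⊗_k N) ℓ` holds over every finite normal `N ⊂ ℂ` over `k`.  Then the
Tate map `ℤ_ℓ ⊗ Hom_k(·,·) → Hom_{Γ_k}(T_ℓ ·, T_ℓ ·)` is bijective for `(A, A′)`, `(A′, A)`, `(A′, A′)`.
Proof: one finite `L′ ⊂ ℂ` rationalises all homomorphisms between `A` and `A′` over every finite `N ⊇ L′`
([Shimura1998] Ch. I §1.2; ★ `exists_intermediateField_forall_le_surjective_homBaseChange`); take `N` normal over
`ℚ` (★ `exists_intermediateField_normal_rat_le`); the complex isogeny, read on `(A ⊗ N) ⊗ ℂ ≅ A ⊗ ℂ`, descends to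
`N` with a quasi-inverse (★ `IsIsogenous.of_surjective_homBaseChange`); conclude by
★ `faltings_tate_bijective_of_isIsogenous_baseChange` («endliche Erweiterung» + Kor. 1 ⇐ Satz 4).
[cite: Faltings1983Endlichkeit, §5 proof of Satz 4 (p. 360) and Korollar 1 (p. 361)]
[cite: Shimura1998, Ch. I §1.2; §18.6 proof of Thm. 18.6 (iv) (p. 127)] -/
theorem faltings_tate_bijective_of_isIsogenous_baseChange_complex {A A' : AbelianVariety k}
    (hiso : IsIsogenous (A.baseChange ℂ) (A'.baseChange ℂ))
    (hA : ∀ N : IntermediateField k ℂ, FiniteDimensional k N → Normal k N →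
      faltings_tate_bijective (A.baseChange N) (A.baseChange N) ℓ) :
    faltings_tate_bijective A A' ℓ ∧ faltings_tate_bijective A' A ℓ ∧ faltings_tate_bijective A' A' ℓ := by
  classical
  -- one finite `L' ⊂ ℂ` over `k` rationalising all homomorphisms between `A`, `A'`, both ways, over every
  -- finite `N ⊇ L'`
  let F : Bool → AbelianVariety k := fun b => cond b A A'
  obtain ⟨L', hL'fd, hL'⟩ := exists_intermediateField_forall_le_surjective_homBaseChange F
  haveI := hL'fd
  -- a finite hull `N ⊇ L'` normal over `ℚ`, hence over `k`
  obtain ⟨N, hNfd, hNnormal, hle, -⟩ := exists_intermediateField_normal_rat_le L' (⊥ : IntermediateField ℚ ℂ)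
  haveI := hNfd
  haveI := hNnormal
  haveI : Normal k N := Normal.tower_top_of_normal ℚ k N
  haveI : NumberField N :=
    { to_charZero := inferInstance
      to_finiteDimensional := FiniteDimensional.trans ℚ k N }
  have h₁ := hL' N hle hNfd true false
  have h₂ := hL' N hle hNfd false true
  -- the complex isogeny read on `(A ⊗ N) ⊗ ℂ ≅ A ⊗ ℂ`, then descended to `N`
  have hisoN : IsIsogenous ((A.baseChange N).baseChange ℂ) ((A'.baseChange N).baseChange ℂ) := by
    obtain ⟨f, hf⟩ := hiso
    exact ⟨(baseChangeTowerIso k N ℂ A).hom ≫ f ≫ (baseChangeTowerIso k N ℂ A').inv,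
      isIsogeny_comp (IsIsogeny.of_iso _)
        (isIsogeny_comp hf (IsIsogeny.of_iso (baseChangeTowerIso k N ℂ A').symm))⟩
  obtain ⟨hN, -⟩ := IsIsogenous.of_surjective_homBaseChange ℂ h₁ h₂ hisoN
  exact faltings_tate_bijective_of_isIsogenous_baseChange N ℓ hN (hA N hNfd inferInstance)

end Complex

/-! ## §2 Two structures of one type `(K, Φ)` are geometrically isogenous -/

section SameType

variable {k : Type} [Field k] [Algebra k ℂ] {K : Type} [Field K] [NumberField K] {Φ : CMType K}
  {A A' : AbelianVariety k} {ι : 𝓞 K →+* End A} {ι' : 𝓞 K →+* End A'}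

/-- **Structures of the same type are geometrically isogenous.**  If `(A, ι)` and `(A′, ι′)` are structures of
type `(K, Φ)` over `k ⊂ ℂ` (`IsCMTypeRealisationOver`; `K` any CM field, `Φ` any CM type), then
`A ⊗_k ℂ ∼ A′ ⊗_k ℂ`: the complexifications are `ℂ^Φ/Φ(𝔞)` and `ℂ^Φ/Φ(𝔟)` for fractional ideals `𝔞, 𝔟`
([Shimura1998] §6.1 Thm. 2, (18.4a); ★ `IsCMTypeRealisationOver.exists_cmTypeUniformization`), and for
`0 ≠ γ ∈ 𝔞⁻¹𝔟` the `(γ𝔟⁻¹𝔞)`-multiplication `S(γ) : ℂ^Φ/Φ(𝔞) → ℂ^Φ/Φ(𝔟)` is an isogeny (§7.4 Prop. 15 with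
§7.1 Prop. 7; ★ `exists_hom_forall_map_r_eq`, ★ `isIsogeny_of_map_r_eq_mul`).
[cite: Shimura1998, §6.1 Thm. 2; §7.4 Prop. 15 (p. 53); §7.1 Prop. 7 (p. 47); §18.4 (18.4a)] -/
theorem IsCMTypeRealisationOver.isIsogenous_baseChange_complex (hA : IsCMTypeRealisationOver Φ A ι)
    (hA' : IsCMTypeRealisationOver Φ A' ι') : IsIsogenous (A.baseChange ℂ) (A'.baseChange ℂ) := by
  classical
  obtain ⟨𝔞, ⟨ξ⟩⟩ := hA.exists_cmTypeUniformization
  obtain ⟨𝔟, ⟨ξ'⟩⟩ := hA'.exists_cmTypeUniformization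
  -- a non-zero `γ ∈ 𝔞⁻¹𝔟`
  have hI : ((𝔞 : FractionalIdeal (𝓞 K)⁰ K)⁻¹ * 𝔟 : FractionalIdeal (𝓞 K)⁰ K) ≠ 0 :=
    mul_ne_zero (inv_ne_zero 𝔞.ne_zero) 𝔟.ne_zero
  obtain ⟨c₀, hc₀0, hc₀⟩ := FractionalIdeal.exists_ne_zero_mem_isInteger hI
  have hc0 : (algebraMap (𝓞 K) K c₀) ≠ 0 := fun h0 =>
    hc₀0 ((map_eq_zero_iff _ (IsFractionRing.injective (𝓞 K) K)).1 h0)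
  -- `S(γ)` and its integral ideal `𝔠 = γ𝔞𝔟⁻¹`
  obtain ⟨ν, -, hνr⟩ := CMTypeUniformization.exists_hom_forall_map_r_eq ξ ξ' hc₀
  obtain ⟨C, hC⟩ := CMTypeLattice.exists_ideal_coe_eq_spanSingleton_mul_mul_inv hc₀
  exact ⟨ν, ξ.isIsogeny_of_map_r_eq_mul ξ' hc0 hC hνr⟩

end SameType

/-! ## §3 The `k`-forms of a CM structure of primitive type / of a CM elliptic structure -/

section Forms

/-- **[Fal83 §5 Kor. 1] for every `k`-form of a variety geometrically isogenous to a CM structure of PRIMITIVE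
type**, granted [Shimura1998, Thm. 18.6].  Let `(A₀, ι₀)` be a structure of type `(K, Φ)` over the number field
`k ⊂ ℂ` with `Φ` primitive, and `A′` ANY abelian variety over `k` with `A₀ ⊗_k ℂ ∼ A′ ⊗_k ℂ`.  Then the Tate map
`ℤ_ℓ ⊗ Hom_k(·,·) → Hom_{Γ_k}(T_ℓ ·, T_ℓ ·)` is bijective for `(A₀, A′)`, `(A′, A₀)` and `(A′, A′)`, for every
prime `ℓ`.  Over each finite normal `N ⊂ ℂ` over `k`, `(A₀ ⊗ N, ι₀ ⊗ N)` is again of type `(K, Φ)`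
(★ `IsCMTypeRealisationOver.baseChange`), so ONE Frobenius acts on `T_ℓ(A₀ ⊗ N)` as `T_ℓ(ι₀ π)` with
`ℚ(π) = K` (Shimura–Taniyama, ★ `exists_tateRep_eq_tateModuleMap_and_adjoin_eq_top_of_isPrimitive`) and the
`End` statement holds there (Serre–Tate §4 Cor. 1, ★ `bijective_faltingsTateMap_of_isCMTypeRealisationOver_of_tateRep_eq`);
§1 descends it.  Covers: twists of `A₀` by finite-order characters, and for `g = 1` every elliptic curve over
`k` with CM by an ORDER of `K` that is geometrically isogenous to `A₀`.
[cite: Faltings1983Endlichkeit, §5 proof of Satz 4 (p. 360) and Korollar 1 (p. 361)]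
[cite: Shimura1998, §13.1 Thm. 1 (ii) (p. 97); §18.6 Thm. 18.6; §8.2 Prop. 26] [cite: SerreTate1968, §4 Theorem 5 and Corollary 1] -/
theorem faltings_tate_bijective_of_isIsogenous_complex_of_isPrimitive_of_thm18_6 (h186 : shimura1998_thm18_6)
    {k : Type} [Field k] [NumberField k] [Algebra k ℂ] {K : Type} [Field K] [NumberField K] [IsCMField K]
    (Φ : CMType K) (A₀ : AbelianVariety k) (ι₀ : 𝓞 K →+* End A₀)
    (hA : IsCMTypeRealisationOver Φ A₀ ι₀) {φ₀ : K →+* ℂ} (hprim : IsPrimitive (ℂ ≃+* ℂ) Φ.1 φ₀)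
    (A' : AbelianVariety k) (hiso : IsIsogenous (A₀.baseChange ℂ) (A'.baseChange ℂ))
    (ℓ : ℕ) [Fact ℓ.Prime] :
    faltings_tate_bijective A₀ A' ℓ ∧ faltings_tate_bijective A' A₀ ℓ ∧ faltings_tate_bijective A' A' ℓ := by
  refine faltings_tate_bijective_of_isIsogenous_baseChange_complex ℓ hiso fun N hNfd hNn => ?_
  haveI := hNfd
  haveI : NumberField N :=
    { to_charZero := inferInstance
      to_finiteDimensional := FiniteDimensional.trans ℚ k N }
  haveI : IsScalarTower k N ℂ := IsScalarTower.of_algebraMap_eq fun _ => rfl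
  have hN : IsCMTypeRealisationOver Φ (A₀.baseChange N) ((A₀.endBaseChange N).comp ι₀) := hA.baseChange
  intro _
  obtain ⟨σ₀, π, hσ₀, hπ⟩ :=
    exists_tateRep_eq_tateModuleMap_and_adjoin_eq_top_of_isPrimitive h186 Φ (A₀.baseChange N) _ hN hprim ℓ
  exact bijective_faltingsTateMap_of_isCMTypeRealisationOver_of_tateRep_eq Φ (A₀.baseChange N) _ hN ℓ σ₀ π hσ₀ hπ

/-- **[Fal83 §5 Kor. 1] for every `k`-form of a variety geometrically isogenous to a CM ELLIPTIC structure**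
(`[K : ℚ] = 2`), granted [Shimura1998, Thm. 18.6]: for a structure `(A₀, ι₀)` of type `(K, Φ)` over `k ⊂ ℂ`
with `K` imaginary quadratic and ANY `A′` over `k` with `A₀ ⊗ ℂ ∼ A′ ⊗ ℂ` — all twists of the CM elliptic
curve `A₀`, and the elliptic curves over `k` with CM by an order of `K` geometrically isogenous to `A₀` — the
Tate map is bijective for `(A₀, A′)`, `(A′, A₀)`, `(A′, A′)`.  The `End` statement over the finite normal
`N ⊂ ℂ` is ★ `faltings_tate_bijective_of_CM_elliptic_of_thm18_6` at `(A₀ ⊗ N, ι₀ ⊗ N)`.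
[cite: Faltings1983Endlichkeit, §5 proof of Satz 4 (p. 360) and Korollar 1 (p. 361)]
[cite: Shimura1998, §18.6 Thm. 18.6; §5.1 Prop. 3] [cite: SerreTate1968, §4 Theorem 5 and Corollary 1] -/
theorem faltings_tate_bijective_of_isIsogenous_complex_of_CM_elliptic_of_thm18_6 (h186 : shimura1998_thm18_6)
    {k : Type} [Field k] [NumberField k] [Algebra k ℂ] {K : Type} [Field K] [NumberField K] [IsCMField K]
    (Φ : CMType K) (A₀ : AbelianVariety k) (ι₀ : 𝓞 K →+* End A₀)
    (hA : IsCMTypeRealisationOver Φ A₀ ι₀) (h2 : Module.finrank ℚ K = 2)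
    (A' : AbelianVariety k) (hiso : IsIsogenous (A₀.baseChange ℂ) (A'.baseChange ℂ))
    (ℓ : ℕ) [Fact ℓ.Prime] :
    faltings_tate_bijective A₀ A' ℓ ∧ faltings_tate_bijective A' A₀ ℓ ∧ faltings_tate_bijective A' A' ℓ := by
  refine faltings_tate_bijective_of_isIsogenous_baseChange_complex ℓ hiso fun N hNfd hNn => ?_
  haveI := hNfd
  haveI : NumberField N :=
    { to_charZero := inferInstance
      to_finiteDimensional := FiniteDimensional.trans ℚ k N }
  haveI : IsScalarTower k N ℂ := IsScalarTower.of_algebraMap_eq fun _ => rfl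
  have h := faltings_tate_bijective_of_CM_elliptic_of_thm18_6 h186 Φ (A₀.baseChange N)
    ((A₀.endBaseChange N).comp ι₀) hA.baseChange h2 ℓ
  intro _
  exact h

end Forms

/-! ## §4 HEADS: two structures of the SAME type (the twist family) -/

section Heads

/-- **[Faltings 1983, §5 Kor. 1] FOR TWO STRUCTURES OF ONE PRIMITIVE CM TYPE**, granted [Shimura1998, Thm. 18.6]
and NOTHING ELSE.  For structures `(A, ι)`, `(A′, ι′)` of the same type `(K, Φ)` (`Φ` primitive; any `g`) over a
number field `k ⊂ ℂ` and every prime `ℓ`, the Tate map `ℤ_ℓ ⊗ Hom_k(A, A′) → Hom_{Γ_k}(T_ℓ A, T_ℓ A′)` is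
bijective — whether or not `A ∼_k A′` (non-`k`-isogenous `k`-forms = twists: both sides vanish; `k`-isogenous:
[Shimura1998] Lemma 19.12 regime).  §2 (geometric isogeny `S(γ)`) + §3.
[cite: Faltings1983Endlichkeit, §5 Korollar 1 (p. 361)] [cite: Shimura1998, §7.4 Prop. 15 (p. 53); §18.6 Thm. 18.6] -/
theorem faltings_tate_bijective_of_sameType_of_isPrimitive_of_thm18_6 (h186 : shimura1998_thm18_6)
    {k : Type} [Field k] [Algebra k ℂ] {K : Type} [Field K] [NumberField K] [IsCMField K]
    (Φ : CMType K) (A A' : AbelianVariety k) (ι : 𝓞 K →+* End A) (ι' : 𝓞 K →+* End A')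
    (hA : IsCMTypeRealisationOver Φ A ι) (hA' : IsCMTypeRealisationOver Φ A' ι')
    {φ₀ : K →+* ℂ} (hprim : IsPrimitive (ℂ ≃+* ℂ) Φ.1 φ₀) (ℓ : ℕ) [Fact ℓ.Prime] :
    faltings_tate_bijective A A' ℓ := by
  -- `[NumberField k]` is the binder of the predicate `faltings_tate_bijective`
  intro hk
  have h := (faltings_tate_bijective_of_isIsogenous_complex_of_isPrimitive_of_thm18_6 h186 Φ A ι hA hprim A'
    (hA.isIsogenous_baseChange_complex hA') ℓ).1
  exact h

/-- **[Faltings 1983, §5 Kor. 1] FOR TWO CM-ELLIPTIC STRUCTURES OF ONE TYPE** (`[K : ℚ] = 2`), granted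
[Shimura1998, Thm. 18.6]: for `(A, ι)`, `(A′, ι′)` of type `(K, Φ)` over the number field `k ⊂ ℂ` — e.g. a CM
elliptic curve and any of its twists carrying the `𝓞_K`-action over `k` — and every prime `ℓ`,
`ℤ_ℓ ⊗ Hom_k(A, A′) → Hom_{Γ_k}(T_ℓ A, T_ℓ A′)` is bijective.  The same-Hecke-character case is
★ `bijective_faltingsTateMap_of_CM_elliptic_pair_of_thm18_6` ([Shimura1998] Lemma 19.12); here no Hecke character,
uniformisation or `k`-isogeny hypothesis is assumed.
[cite: Faltings1983Endlichkeit, §5 Korollar 1 (p. 361)] [cite: Shimura1998, §7.4 Prop. 15 (p. 53); §18.6 Thm. 18.6] -/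
theorem faltings_tate_bijective_of_sameType_of_CM_elliptic_of_thm18_6 (h186 : shimura1998_thm18_6)
    {k : Type} [Field k] [Algebra k ℂ] {K : Type} [Field K] [NumberField K] [IsCMField K]
    (Φ : CMType K) (A A' : AbelianVariety k) (ι : 𝓞 K →+* End A) (ι' : 𝓞 K →+* End A')
    (hA : IsCMTypeRealisationOver Φ A ι) (hA' : IsCMTypeRealisationOver Φ A' ι') (h2 : Module.finrank ℚ K = 2)
    (ℓ : ℕ) [Fact ℓ.Prime] : faltings_tate_bijective A A' ℓ := by
  intro hk
  have h := (faltings_tate_bijective_of_isIsogenous_complex_of_CM_elliptic_of_thm18_6 h186 Φ A ι hA h2 A'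
    (hA.isIsogenous_baseChange_complex hA') ℓ).1
  exact h

end Heads

/-! ## §5 Products of structures of one type -/

section Products

/-- **[Faltings 1983, §5 Kor. 1] for varieties isogenous to PRODUCTS of structures of one primitive type**, granted
[Shimura1998, Thm. 18.6]: for finite families `(Aⱼ, ιⱼ)`, `(Bⱼ′, ι′ⱼ′)` of structures of the same primitive type
`(K, Φ)` over the number field `k ⊂ ℂ`, and `A ∼ ⨁ Aⱼ`, `B ∼ ⨁ Bⱼ′` over `k`, the Tate map for `(A, B)` is bijective
(§4 for every pair of factors + additivity over finite biproducts, ★ `faltings_tate_bijective_of_isIsogenous_biproduct_biproduct`).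
[cite: Faltings1983Endlichkeit, §5 Korollar 1] [cite: Shimura1998, §7.4 Prop. 15 (p. 53); §18.6 Thm. 18.6] -/
theorem faltings_tate_bijective_of_isIsogenous_biproduct_sameType_of_isPrimitive_of_thm18_6
    (h186 : shimura1998_thm18_6)
    {k : Type} [Field k] [Algebra k ℂ] {K : Type} [Field K] [NumberField K] [IsCMField K]
    (Φ : CMType K) {φ₀ : K →+* ℂ} (hprim : IsPrimitive (ℂ ≃+* ℂ) Φ.1 φ₀)
    {J J' : Type} [Fintype J] [Fintype J'] (E : J → AbelianVariety k) (ι : ∀ j, 𝓞 K →+* End (E j))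
    (E' : J' → AbelianVariety k) (ι' : ∀ j', 𝓞 K →+* End (E' j'))
    (hE : ∀ j, IsCMTypeRealisationOver Φ (E j) (ι j)) (hE' : ∀ j', IsCMTypeRealisationOver Φ (E' j') (ι' j'))
    {A B : AbelianVariety k} (hA : IsIsogenous (⨁ E) A) (hB : IsIsogenous (⨁ E') B) (ℓ : ℕ) [Fact ℓ.Prime] :
    faltings_tate_bijective A B ℓ :=
  faltings_tate_bijective_of_isIsogenous_biproduct_biproduct ℓ E E' hA hB fun j j' =>
    faltings_tate_bijective_of_sameType_of_isPrimitive_of_thm18_6 h186 Φ (E j) (E' j') (ι j) (ι' j') (hE j) (hE' j')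
      hprim ℓ

/-- **[Faltings 1983, §5 Kor. 1] for varieties isogenous to PRODUCTS OF CM-ELLIPTIC structures of one type**
(`[K : ℚ] = 2`; e.g. two products of twists of one CM elliptic curve over `k`), granted [Shimura1998, Thm. 18.6].
[cite: Faltings1983Endlichkeit, §5 Korollar 1] [cite: Shimura1998, §7.4 Prop. 15 (p. 53); §18.6 Thm. 18.6] -/
theorem faltings_tate_bijective_of_isIsogenous_biproduct_sameType_of_CM_elliptic_of_thm18_6
    (h186 : shimura1998_thm18_6)
    {k : Type} [Field k] [Algebra k ℂ] {K : Type} [Field K] [NumberField K] [IsCMField K]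
    (Φ : CMType K) (h2 : Module.finrank ℚ K = 2)
    {J J' : Type} [Fintype J] [Fintype J'] (E : J → AbelianVariety k) (ι : ∀ j, 𝓞 K →+* End (E j))
    (E' : J' → AbelianVariety k) (ι' : ∀ j', 𝓞 K →+* End (E' j'))
    (hE : ∀ j, IsCMTypeRealisationOver Φ (E j) (ι j)) (hE' : ∀ j', IsCMTypeRealisationOver Φ (E' j') (ι' j'))
    {A B : AbelianVariety k} (hA : IsIsogenous (⨁ E) A) (hB : IsIsogenous (⨁ E') B) (ℓ : ℕ) [Fact ℓ.Prime] :
    faltings_tate_bijective A B ℓ :=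
  faltings_tate_bijective_of_isIsogenous_biproduct_biproduct ℓ E E' hA hB fun j j' =>
    faltings_tate_bijective_of_sameType_of_CM_elliptic_of_thm18_6 h186 Φ (E j) (E' j') (ι j) (ι' j') (hE j) (hE' j')
      h2 ℓ

end Products

end Literature.NumberTheory.ComplexMultiplication

end
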